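import Summits.QuantumFields.GaugeBoot.ClassBHaarShift
import Summits.QuantumFields.GaugeBoot.ClassBLimitSymmetry
import Literature.MathematicalPhysics.QuantumFieldTheory.Balaban1983to89.InfiniteVolumeSufficientIV
import HarnessLib

/-!
# What is known of the Class-B identification for torus limit points (gauge-boot, L3(α) status)

HONEST FRAMING (cell `pub-gaugeboot`, page 1 of every file): the venture produces certified bounds
on lattice expectations at stated coupling, gauge group, dimension and torus size; NOT a mass gap,
NOT a continuum limit, NOT a string tension; NOT Yang–Mills-summit-bearing (barriers
`FixedCouplingUltralocality`, `PerturbativeInvisibility`).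

`ClassBState ρ β` (`ClassB.lean`) has seven fields besides the measure: probability, translation
invariance, axis-permutation invariance, axis-reflection invariance, the one-link Haar-shift
identity, and the three reflection positivities (site, link, diagonal). For an infinite-volume
limit point `μ` of the torus Wilson states this file records, as ONE theorem
(`classBInvariances_of_mem_infiniteVolumeLimitPoints`), the five that are now PROVED in the tree:

* probability (definition of a limit point);
* `IsZdTranslationInvariant μ` (`isZdTranslationInvariant_of_mem_infiniteVolumeLimitPoints`, tree);
* `MeasurePreserving (configPerm σ) μ μ` (`permInvariant_of_mem_infiniteVolumeLimitPoints`);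
* `MeasurePreserving (configSiteReflect i) μ μ` (`reflectInvariant_of_mem_infiniteVolumeLimitPoints`);
* `IsHaarShiftState ρ β μ` (`isHaarShiftState_of_mem_infiniteVolumeLimitPoints`).

NOT proved here (and not claimed): site and link reflection positivity of limit points (true on
every torus — `wilsonExpectation_reflectionPositive_holds` and the site/odd-torus companions — but
the passage to the limit for bounded MEASURABLE half-space observables needs an `L²`-density
argument that is not in the tree), and diagonal reflection positivity, which is the OPEN
`TorusLimitPointsDiagonalRP` (refuted on every finite torus, `not_diagonalReflectionPositive`;
proved for symmetric finite volumes, `DiagRP.isReflectionPositiveFor_diag_ymSpecification`).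
Consequently `ThermodynamicLimitIsClassB` is, as of this file, reduced to those three RP statements.
-/

noncomputable section

open MeasureTheory
open Literature.MathematicalPhysics.QuantumLattice

namespace Summit.QuantumFields.GaugeBoot

variable {d N : ℕ} [NeZero d] {G : Type*} [Group G] [TopologicalSpace G] [IsTopologicalGroup G]
  [CompactSpace G] [MeasurableSpace G] [BorelSpace G] [T2Space G] [SecondCountableTopology G]
variable (ρ : G →* Matrix (Fin N) (Fin N) ℂ)

/-- **The invariance half of the Class-B identification for torus limit points.** Every
infinite-volume limit point `μ` of the torus Wilson states (continuous `ρ`, any real `β`) is a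
probability measure which is translation invariant, invariant under the axis permutations and the
axis reflections of `ClassB.lean`, and satisfies the one-link Haar-shift (Gibbs) identity
`IsHaarShiftState ρ β μ`. (The three reflection positivities are NOT asserted; see the module
docstring.) -/
theorem classBInvariances_of_mem_infiniteVolumeLimitPoints (hρ : Continuous ρ) {β : ℝ}
    {μ : Measure (LGConfig d G)} (hμ : μ ∈ infiniteVolumeLimitPoints (d := d) ρ β) :
    IsProbabilityMeasure μ ∧ IsZdTranslationInvariant μ ∧
      (∀ σ : Equiv.Perm (Fin d), MeasurePreserving (configPerm σ) μ μ) ∧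
      (∀ i : Fin d, MeasurePreserving (configSiteReflect i) μ μ) ∧ IsHaarShiftState ρ β μ := by
  obtain ⟨L, _, hprob, _⟩ := id hμ
  exact ⟨hprob, isZdTranslationInvariant_of_mem_infiniteVolumeLimitPoints ρ hμ,
    fun σ => permInvariant_of_mem_infiniteVolumeLimitPoints ρ hρ hμ σ,
    fun i => reflectInvariant_of_mem_infiniteVolumeLimitPoints ρ hρ hμ i,
    isHaarShiftState_of_mem_infiniteVolumeLimitPoints ρ hρ hμ⟩

/-- **What the identification now hinges on.** If an infinite-volume limit point of the torus
Wilson states is reflection positive for the three mirror families of `ClassB.lean` (sites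
`x_i = 0`, links `x_i = ½`, diagonals `x_i = x_j`), then it is (the measure of) a Class-B state.
The site and link hypotheses hold on every finite torus (their inheritance by the limit is not
formalised); the diagonal one is the OPEN `TorusLimitPointsDiagonalRP`. -/
theorem exists_classBState_of_reflectionPositive (hρ : Continuous ρ) {β : ℝ}
    {μ : Measure (LGConfig d G)} (hμ : μ ∈ infiniteVolumeLimitPoints (d := d) ρ β)
    (hsite : ∀ i : Fin d, IsReflectionPositiveFor (configSiteReflect i) (siteHalfEdges i) μ)
    (hlink : ∀ i : Fin d, IsReflectionPositiveFor (configLinkReflect i) (linkHalfEdges i) μ)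
    (hdiag : ∀ i j : Fin d, i ≠ j →
      IsReflectionPositiveFor (configDiagSwapZd (G := G) i j) (diagHalfEdges i j) μ) :
    ∃ ω : ClassBState d ρ β, ω.μ = μ := by
  obtain ⟨hprob, htrans, hperm, hrefl, hhaar⟩ :=
    classBInvariances_of_mem_infiniteVolumeLimitPoints ρ hρ hμ
  exact ⟨⟨μ, hprob, htrans, hperm, hrefl, hhaar, hsite, hlink, hdiag⟩, rfl⟩

end Summit.QuantumFields.GaugeBoot
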